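import Summits.QuantumFields.YangMills.Theorems.IR.BlockedActivityWFormatRobust
import Summits.QuantumFields.YangMills.Theorems.IR.BlockedActivityWOnset
import HarnessLib

/-!
# Crux `IR` (stmt-QuantumFields-19354), lane B «strong coupling AFTER BLOCKING»: a UNIFORM coarsening threshold and the canonical form of the
# CALIBRATED universal currency `SharpOnset.UnivOnsetSharpSC` (grade-robust WITH the NT calibration `a(β)·b < T`)

Helper module for item `stmt-QuantumFields-19354` (`--supports`; it closes nothing), lane `ym-19354-onsetsc-p2` (g6); sequel of
`Theorems/IR/BlockedActivityWFormatRobust`.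

* ★ `univShellCond_coarsening_threshold` — for a grade `(n, ε)` (`0 ≤ ε`, `ε·shellCount n < 1`) and a target grade `(n', ε')` (`n' ≥ 1`, `ε' > 0`) there is ONE
  `K₀ = K₀(n, ε; n', ε')` — independent of `G, ρ, β, b` — such that `UnivShellCond ρ β b n ε ⇒ UnivShellCond ρ β (K·b) n' ε'` for all `K ≥ K₀`, `b ≥ 1`
  (continuous `ρ`, Hausdorff second-countable `G`).
* ★ `univOnsetSharpSC_iff_grade_one` — the calibrated σ-uniform currency of record (`UnivOnsetSharpSC`, whose consequence `ir_of_univOnsetSharpSC : UnivOnsetSharpSC →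
  IRNSC → IR` is in the tree) in CANONICAL form: `UnivOnsetSharpSC ↔` «every SC compact simple `G`, `r`, unit `a` with `LowerBounds G r a`: `∃ T β₂, ∀ β ≥ β₂, ∃ b ≥ 1,
  a(β)·b < T ∧ UnivShellCond r.ρ β b 1 (1∕3552)`»; `univOnsetSharpSC_iff_lt_one` — the Uc threshold `ε·shellCount n ≤ 3∕4` may be replaced by the Dobrushin–Shlosman
  threshold `< 1` (the bootstrap p522910 did this at fixed mesh by growing the window; here at window `1` by mesh multiples, calibration kept: `T ↦ K₀·T`).

HONEST FRAMING: format bookkeeping at every `β`; `UnivOnsetSharpSC` is OPEN (and exposed to `OnsetWire.UniformWire`, p533919); nothing asserts it, nor a gap, nor Clay.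
No `sorry`; axioms ⊆ {propext, Classical.choice, Quot.sound}; no instances, no notation.
-/

set_option autoImplicit false

noncomputable section

open MeasureTheory ProbabilityTheory Filter Topology
open Literature.MathematicalPhysics
open Literature.MathematicalPhysics.QuantumFieldTheory (LatticeRep IsCompactSimpleLieGroup)
open Literature.MathematicalPhysics.QuantumLattice
open Summit.QuantumFields.YangMills.Cruxes.OSLegsFromFemtoAndGap.DlrCollarTransfer (LowerBounds)
open Summit.QuantumFields.YangMills.Cruxes.IR.OnsetFormats (shellCount UnivShellCond OnsetMixing)
open Summit.QuantumFields.YangMills.Cruxes.IR.AfPincerUc.SharpOnset (UnivOnsetSharpSC)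

namespace Summit.QuantumFields.YangMills.Cruxes.IR.BlockedActivity

/-! ## §1 A uniform coarsening threshold -/

section Threshold

variable {G : Type} [Group G] [TopologicalSpace G] [IsTopologicalGroup G] [CompactSpace G] [MeasurableSpace G] [BorelSpace G]
  [SecondCountableTopology G] [T2Space G] {N : ℕ} (ρ : G →* Matrix (Fin N) (Fin N) ℂ)

/-- ★ **Uniform coarsening threshold.**  For `0 ≤ ε`, `ε·shellCount n < 1`, `n' ≥ 1`, `ε' > 0` there is `K₀` (depending on `n, ε, n', ε'` only) with:
for every continuous `ρ`, every `β`, every `b ≥ 1` and every `K ≥ K₀`, `UnivShellCond ρ β b n ε → UnivShellCond ρ β (K·b) n' ε'`. -/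
theorem univShellCond_coarsening_threshold (hρ : Continuous ρ) {ε : ℝ} {n : ℕ} (hε : 0 ≤ ε) (hlt : ε * shellCount n < 1)
    {n' : ℕ} (hn' : 1 ≤ n') {ε' : ℝ} (hε' : 0 < ε') :
    ∃ K₀ : ℕ, ∀ K : ℕ, K₀ ≤ K → ∀ (β : ℝ) (b : ℕ), 1 ≤ b → UnivShellCond ρ β b n ε → UnivShellCond ρ β (K * b) n' ε' := by
  have hθ0 : 0 ≤ ε * shellCount n := mul_nonneg hε (shellCount_nonneg' n)
  have hT := pow_four_mul_geom_tendsto_zero hθ0 hlt (2 * n + 1) (2 * n + 1) 1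
  obtain ⟨j₀, hj₀⟩ := eventually_atTop.1 (hT.eventually (gt_mem_nhds hε'))
  refine ⟨j₀ * (2 * n + 1) + 1, fun K hK β b hb hU => ?_⟩
  have hpos : 0 < 2 * n + 1 := by omega
  have hjK : 2 * K / (2 * n + 1) * (2 * n + 1) ≤ 2 * K := Nat.div_mul_le_self (2 * K) (2 * n + 1)
  have hlt' : 2 * K < 2 * K / (2 * n + 1) * (2 * n + 1) + (2 * n + 1) := Nat.lt_div_mul_add hpos
  have hKj : K ≤ (2 * K / (2 * n + 1) * (2 * n + 1) + (2 * n + 1)) * 1 := by omega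
  have hj₀j : j₀ ≤ 2 * K / (2 * n + 1) := (Nat.le_div_iff_mul_le hpos).2 (by omega)
  have hK1 : 1 ≤ K := by omega
  have hUc := univShellCond_coarsen_window ρ hρ hb hε hU hn' (2 * K / (2 * n + 1)) hK1 hjK
  set j : ℕ := 2 * K / (2 * n + 1) with hj
  refine univShellCond_of_le ρ hUc ?_
  have hθj : 0 ≤ (ε * shellCount n) ^ j := pow_nonneg hθ0 j
  have hKle : (K : ℝ) ≤ ((((j * (2 * n + 1) + (2 * n + 1)) * 1 : ℕ)) : ℝ) := by exact_mod_cast hKj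
  have hK0 : (0 : ℝ) ≤ (K : ℝ) := Nat.cast_nonneg K
  calc (K : ℝ) ^ 4 * (ε * shellCount n) ^ j ≤ ((((j * (2 * n + 1) + (2 * n + 1)) * 1 : ℕ)) : ℝ) ^ 4 * (ε * shellCount n) ^ j := by gcongr
    _ ≤ ε' := (hj₀ j hj₀j).le

/-- **Calibrated grade robustness (per `(G, ρ)` and unit `a`)**: a calibrated universal onset (`∃ T β₂, ∀ β ≥ β₂, ∃ b ≥ 1, a(β)·b < T ∧ UnivShellCond ρ β b n ε`) at SOME
grade with `ε·shellCount n < 1` gives one at EVERY grade `(n', ε')` (`n' ≥ 1`, `ε' > 0`), with `T ↦ K₀·T`. -/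
theorem calibratedUnivOnsetAt_grade_robust (hρ : Continuous ρ) {a : ℝ → ℝ} {ε : ℝ} {n : ℕ} (hε : 0 ≤ ε)
    (hlt : ε * shellCount n < 1) (h : ∃ T β₂ : ℝ, ∀ β : ℝ, β₂ ≤ β → ∃ b : ℕ, 1 ≤ b ∧ a β * (b : ℝ) < T ∧ UnivShellCond ρ β b n ε)
    {n' : ℕ} (hn' : 1 ≤ n') {ε' : ℝ} (hε' : 0 < ε') :
    ∃ T β₂ : ℝ, ∀ β : ℝ, β₂ ≤ β → ∃ b : ℕ, 1 ≤ b ∧ a β * (b : ℝ) < T ∧ UnivShellCond ρ β b n' ε' := by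
  obtain ⟨K₀, hK₀⟩ := univShellCond_coarsening_threshold ρ hρ hε hlt hn' hε'
  obtain ⟨T, β₂, hβ⟩ := h
  refine ⟨((K₀ + 1 : ℕ) : ℝ) * T, β₂, fun β hb => ?_⟩
  obtain ⟨b, hb1, hcal, hU⟩ := hβ β hb
  refine ⟨(K₀ + 1) * b, hb1.trans (Nat.le_mul_of_pos_left b (Nat.succ_pos K₀)), ?_, hK₀ (K₀ + 1) (Nat.le_succ K₀) β b hb1 hU⟩
  have hK : (0 : ℝ) < ((K₀ + 1 : ℕ) : ℝ) := by positivity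
  push_cast at hK ⊢
  have : a β * (((K₀ : ℝ) + 1) * (b : ℝ)) = ((K₀ : ℝ) + 1) * (a β * (b : ℝ)) := by ring
  rw [this]
  exact mul_lt_mul_of_pos_left hcal hK

end Threshold

/-! ## §2 The calibrated σ-uniform currency in canonical form -/

/-- ★ **`UnivOnsetSharpSC` in canonical single-grade form**: `UnivOnsetSharpSC ↔` «for every simply connected compact simple `G`, every `r`, every unit `a → 0⁺` with
`LowerBounds G r a`: `∃ T β₂, ∀ β ≥ β₂, ∃ b ≥ 1, a(β)·b < T ∧ UnivShellCond r.ρ β b 1 (1∕3552)`». -/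
theorem univOnsetSharpSC_iff_grade_one :
    UnivOnsetSharpSC ↔
      ∀ (G : Type) [Group G] [TopologicalSpace G] [IsTopologicalGroup G] [CompactSpace G],
        IsCompactSimpleLieGroup G → SimplyConnectedSpace G →
        letI : MeasurableSpace G := borel G; haveI : BorelSpace G := ⟨rfl⟩;
        ∀ (r : LatticeRep G) (a : ℝ → ℝ), (∀ β, 0 < a β) → Tendsto a atTop (𝓝 0) → LowerBounds G r a →
          ∃ T β₂ : ℝ, ∀ β : ℝ, β₂ ≤ β → ∃ b : ℕ, 1 ≤ b ∧ a β * (b : ℝ) < T ∧ UnivShellCond r.ρ β b 1 (1 / 3552) := by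
  constructor
  · intro h G _ _ _ _ hG hsc
    letI : MeasurableSpace G := borel G
    haveI : BorelSpace G := ⟨rfl⟩
    intro r a ha hat hlb
    haveI := r.t2Space
    haveI := r.secondCountableTopology
    obtain ⟨n, ε, -, hε, hM, hrest⟩ := h G hG hsc r a ha hat hlb
    exact calibratedUnivOnsetAt_grade_robust r.ρ r.continuous hε (by linarith) hrest le_rfl (by norm_num)
  · intro h G _ _ _ _ hG hsc
    letI : MeasurableSpace G := borel G
    haveI : BorelSpace G := ⟨rfl⟩
    intro r a ha hat hlb
    exact ⟨1, 1 / 3552, le_rfl, by norm_num, by rw [shellCount_one]; norm_num, h G hG hsc r a ha hat hlb⟩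

/-- **The Uc threshold is immaterial**: `UnivOnsetSharpSC ↔` the same statement with the Dobrushin–Shlosman threshold `ε·shellCount n < 1` in place of `≤ 3∕4`. -/
theorem univOnsetSharpSC_iff_lt_one :
    UnivOnsetSharpSC ↔
      ∀ (G : Type) [Group G] [TopologicalSpace G] [IsTopologicalGroup G] [CompactSpace G],
        IsCompactSimpleLieGroup G → SimplyConnectedSpace G →
        letI : MeasurableSpace G := borel G; haveI : BorelSpace G := ⟨rfl⟩;
        ∀ (r : LatticeRep G) (a : ℝ → ℝ), (∀ β, 0 < a β) → Tendsto a atTop (𝓝 0) → LowerBounds G r a →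
          ∃ (n : ℕ) (ε : ℝ), 1 ≤ n ∧ 0 ≤ ε ∧ ε * shellCount n < 1 ∧
            ∃ T β₂ : ℝ, ∀ β : ℝ, β₂ ≤ β → ∃ b : ℕ, 1 ≤ b ∧ a β * (b : ℝ) < T ∧ UnivShellCond r.ρ β b n ε := by
  rw [univOnsetSharpSC_iff_grade_one]
  constructor
  · intro h G _ _ _ _ hG hsc
    letI : MeasurableSpace G := borel G
    haveI : BorelSpace G := ⟨rfl⟩
    intro r a ha hat hlb
    exact ⟨1, 1 / 3552, le_rfl, by norm_num, by rw [shellCount_one]; norm_num, h G hG hsc r a ha hat hlb⟩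
  · intro h G _ _ _ _ hG hsc
    letI : MeasurableSpace G := borel G
    haveI : BorelSpace G := ⟨rfl⟩
    intro r a ha hat hlb
    haveI := r.t2Space
    haveI := r.secondCountableTopology
    obtain ⟨n, ε, -, hε, hlt, hrest⟩ := h G hG hsc r a ha hat hlb
    exact calibratedUnivOnsetAt_grade_robust r.ρ r.continuous hε hlt hrest le_rfl (by norm_num)

end Summit.QuantumFields.YangMills.Cruxes.IR.BlockedActivity

end
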